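import Mathlib
import HarnessLib
import Summits.ResolutionOfSingularities.ResolutionOfSingularities.Theorems.WildQuotientsWildQuotientResolutionS1aModelTools
import Summits.ResolutionOfSingularities.ResolutionOfSingularities.Theorems.WildQuotientsWildQuotientResolutionS1aChartRingSigma

/-!
# S1a — R4c cusp, brick (b3-bhat): the INVARIANT DEGREE-0 ELEMENT `b̂ = Z^D · c^{−deg Z}` of a producer chart ring (the element inverted by a member chart)

[OURS · L1 W4.5c · lead-1 g17; plan-1 RULING R-F15v (2) ★ R4c `cusp_killsIn_two`, memo `Cruxes/CyclicQuotientFourfolds/Lines/s1a_logminvertex-R4c-PROGRESS.md` §2/§4: the member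
charts `U = W ∩ D(b)` of the cusp invert, on the producer chart `W` of the cover element `c = yT^D`, the section `b` whose chart-ring value is `b̂ = Z^D / c^{dZ}` for a
`σ_R`-FIXED bihomogeneous `Z ∈ R^w` of bidegree `(dZ, 0)` (`Z` = norm of `u₂′` times norm of the member-row unit). This file: `b̂` has degree `0` in the node grading of
the chart (`bHat_mem_chartNodeGrading_zero`), is fixed by `σ_chart` (`sigmaChart_bHat`), and its image under any model `Φ` is ASSOCIATED to `Φ(Z/1)^D`
(`associated_map_bHat`) — the inputs `hσb`, `hΦb` of ✓`exists_principalCentreChartSec_of_memberAway` / ✓`exists_awayModelEquiv`] — NOT statements of the manuscript;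
counted 0; AI-level work, weaker than expert review. Crux stmt-ResolutionOfSingularities-17941 `CyclicQuotientFourfolds`, line `s1a-logminvertex` v13 (`stub_reachLowerInFX`).
-/

set_option linter.dupNamespace false

noncomputable section

open Literature.AlgebraicGeometry.Resolution
open scoped LaurentPolynomial
open Summit.ResolutionOfSingularities.ResolutionOfSingularities.Theorems.WildQuotientResolution.S1
open Summit.ResolutionOfSingularities.ResolutionOfSingularities.Theorems.WildQuotientResolution.S1.CoarseChart
open Summit.ResolutionOfSingularities.ResolutionOfSingularities.Theorems.WildQuotientResolution.S1.ProducerStep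
open Summit.ResolutionOfSingularities.ResolutionOfSingularities.Theorems.WildQuotientResolution.S1.ReesBigrading
open Summit.ResolutionOfSingularities.ResolutionOfSingularities.Theorems.WildQuotientResolution.S1.NodeTransport
open Summit.ResolutionOfSingularities.ResolutionOfSingularities.Theorems.WildQuotientResolution.S1.CobordantTransport
open Summit.ResolutionOfSingularities.ResolutionOfSingularities.Theorems.WildQuotientResolution.S1.BlowupCharts

namespace Summit.ResolutionOfSingularities.ResolutionOfSingularities.Theorems.WildQuotientResolution.S1.FreeModel

variable {m : ℕ} (r : Fin m → ℕ) {B : Type} [CommRing B] (𝒜 : (Π j : Fin m, ZMod (r j)) → AddSubgroup B) [GradedRing 𝒜] {c : ℕ}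
  (f : Fin c → B) {δ : Fin c → Π j : Fin m, ZMod (r j)} (w : Fin c → ℕ) (hf : ∀ i, f i ∈ 𝒜 (δ i))
  (D : ℕ) (b : ↥(𝒜 0)) (hb : b ∈ (traceFiltration 𝒜 f w).ideal D)
  (Z : ↥(cobordantAlgebra f w)) (dZ : ℕ) (hZ : Z ∈ reesPiece 𝒜 f w ((((dZ : ℕ)) : ℤ), (0 : Π j : Fin m, ZMod (r j))))

include hf hZ in
/-- `Z^D` has bidegree `(dZ·D, 0)`. -/
theorem pow_mem_reesPiece_natDeg : Z ^ D ∈ reesPiece 𝒜 f w ((((dZ * D : ℕ)) : ℤ), (0 : Π j : Fin m, ZMod (r j))) := by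
  letI := reesGradedRing 𝒜 f w hf
  have h := SetLike.pow_mem_graded D hZ
  have e1 : D • ((((dZ : ℕ)) : ℤ), (0 : Π j : Fin m, ZMod (r j))) = ((((dZ * D : ℕ)) : ℤ), (0 : Π j : Fin m, ZMod (r j))) := by
    refine Prod.ext ?_ ?_
    · change D • (((dZ : ℕ) : ℤ)) = (((dZ * D : ℕ)) : ℤ); rw [nsmul_eq_mul]; push_cast; ring
    · change D • (0 : Π j : Fin m, ZMod (r j)) = 0; exact smul_zero _
  rwa [e1] at h

include hZ in
/-- ★ **`b̂ = Z^D · c^{−dZ}` has degree `0`** in the node grading of the chart of `c = yT^D`. [OURS · L1 W4.5c · R4c] -/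
theorem bHat_mem_chartNodeGrading_zero : ((algebraMap ↥(cobordantAlgebra f w) (ChartRing 𝒜 f w D b hb)) (Z ^ D) * IsLocalization.Away.invSelf (coverElement 𝒜 f w D b hb) ^ dZ) ∈ (chartNodeGrading r 𝒜 f w hf D b hb) 0 := by
  letI := chartNodeGradedRing r 𝒜 f w hf D b hb
  have h1 := algebraMap_mem_chartNodeGrading r 𝒜 f w hf D b hb (pow_mem_reesPiece_natDeg r 𝒜 f w hf D Z dZ hZ)
  have h2 := SetLike.pow_mem_graded dZ (invSelf_mem_chartNodeGrading r 𝒜 f w hf D b hb)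
  have h := SetLike.mul_mem_graded h1 h2
  have hidx : consIndexEquiv r ((((dZ * D : ℕ)) : ℤ), (0 : Π j : Fin m, ZMod (r j))) + dZ • consIndexEquiv r (-(D : ℤ), (0 : Π j : Fin m, ZMod (r j))) = 0 := by
    rw [← map_nsmul, ← map_add, ← map_zero (consIndexEquiv r)]
    congr 1
    refine Prod.ext ?_ ?_
    · change (((dZ * D : ℕ)) : ℤ) + dZ • (-(D : ℤ)) = 0; rw [nsmul_eq_mul]; push_cast; ring
    · change (0 : Π j : Fin m, ZMod (r j)) + dZ • (0 : Π j : Fin m, ZMod (r j)) = 0; rw [smul_zero, add_zero]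
  rwa [hidx] at h

section Sigma

variable (σ : B ≃+* B) (hσJ : ∀ n : ℕ, ((weightedFiltration f w).ideal n).map (σ : B →+* B) ≤ (weightedFiltration f w).ideal n)
  {p : ℕ} (hp : 0 < p) (hσp : ∀ x : B, (⇑σ)^[p] x = x) (hσb : σ (b : B) = b)

/-- ★ **`σ_chart` fixes `b̂`** as soon as `σ_R` fixes `Z`. [OURS · L1 W4.5c · R4c] -/
theorem sigmaChart_bHat (hσZ : sigmaR σ f w hσJ hp hσp Z = Z) : (sigmaChart 𝒜 f w D b hb σ hσJ hp hσp hσb) ((algebraMap ↥(cobordantAlgebra f w) (ChartRing 𝒜 f w D b hb)) (Z ^ D) * IsLocalization.Away.invSelf (coverElement 𝒜 f w D b hb) ^ dZ) = ((algebraMap ↥(cobordantAlgebra f w) (ChartRing 𝒜 f w D b hb)) (Z ^ D) * IsLocalization.Away.invSelf (coverElement 𝒜 f w D b hb) ^ dZ) := by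
  rw [sigmaChart_algebraMap_mul_invSelf_pow, map_pow, hσZ]

end Sigma

/-- ★ **`Φ b̂` is associated to `Φ(Z/1)^D`** for every ring isomorphism `Φ` out of the chart ring (`c⁻¹` is a unit). [OURS · L1 W4.5c · R4c] -/
theorem associated_map_bHat {P : Type} [CommRing P] (Φ : (ChartRing 𝒜 f w D b hb) ≃+* P) {Z' : P} (hZ' : Φ ((algebraMap ↥(cobordantAlgebra f w) (ChartRing 𝒜 f w D b hb)) Z) = Z') : Associated (Φ ((algebraMap ↥(cobordantAlgebra f w) (ChartRing 𝒜 f w D b hb)) (Z ^ D) * IsLocalization.Away.invSelf (coverElement 𝒜 f w D b hb) ^ dZ)) (Z' ^ D) := by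
  have hu : IsUnit (IsLocalization.Away.invSelf ((coverElement 𝒜 f w D b hb)) : (ChartRing 𝒜 f w D b hb)) :=
    IsUnit.of_mul_eq_one (algebraMap ↥(cobordantAlgebra f w) (ChartRing 𝒜 f w D b hb) (coverElement 𝒜 f w D b hb)) (by rw [mul_comm]; exact IsLocalization.Away.mul_invSelf _)
  rw [map_mul, map_pow (algebraMap ↥(cobordantAlgebra f w) (ChartRing 𝒜 f w D b hb)), map_pow Φ, map_pow Φ, hZ']
  exact (associated_mul_unit_right (Z' ^ D) _ ((hu.map Φ).pow dZ)).symm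

end Summit.ResolutionOfSingularities.ResolutionOfSingularities.Theorems.WildQuotientResolution.S1.FreeModel

end
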